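import Summits.AtomisticToContinuum.HydrodynamicLimit.Theses.JParityClosure
import Summits.AtomisticToContinuum.HydrodynamicLimit.Theses.StrongClosureWeakBV
import Summits.AtomisticToContinuum.HydrodynamicLimit.Theorems.DensityCap.Negative.LimitOrder
import Summits.AtomisticToContinuum.HydrodynamicLimit.Theorems.DensityCap.Negative.Untied

/-!
# Line `weak-lln-upgrade` — crux `JParityClosure.DensityCap` (stmt-AtomisticToContinuum-13082)

Checked skeleton of the crux idea `weak-lln-upgrade` (`Cruxes/DensityCap/Ideas/weak-lln-upgrade.md`; typed
backbone `Cruxes/DensityCap/IdeatorOneSketch.lean`), sharpened by the round-1 triage panel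
(`TRIAGE-r1-{1,2,3}.md`: pass ×3, merge group DOCK). Line card: `Cruxes/DensityCap/Lines/weak-lln-upgrade.md`.

THE LINE. `DensityCap` (no overcompression before the shock, uniformly on `[0,t] × 𝕋³`, `N → ∞` at fixed
resolution `r`, then `r → 0`) is the uniform-in-time, one-sided DENSITY LAW OF LARGE NUMBERS; it closes from
the fixed-time convergence of the hydrodynamic fields by PURE KINEMATICS, and the fixed-time convergence is
docked on the two filed items that already carry it:

* `stub_clock`   — TRANSPORT-LIPSCHITZ CLOCK (the card's lever `TransportLipschitz` = triage's
  `CapPropagationPathwise`, general form): along every good orbit of any hard-sphere flow on `𝕋³` positions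
  move by free flight only, so the empirical average of an `L`-Lipschitz position test is Lipschitz in time
  with constant `L·√(2K/N)`, `K` the conserved kinetic energy. Pathwise, `N`-uniform, degree-2 velocity input
  only, no cutoff. [M, provable now]
* `stub_upgrade` — GRID UPGRADE (the card's `UpgradeLemma` = Disproof §6 near-miss = IdeatorThree's
  `GridUpgrade`): GIVEN the clock, convergence in probability of the fields at EVERY `s ∈ [0,t]` implies the
  cap: finite `(s,x)`-grid of `N`-independent size, space modulus `3/(π r⁴)` (`euclidDist_triangle`), time
  modulus = the clock with `χ = b_r(·,x)`, `L = 3/(π r⁴)` on `{K/N ≤ ∫E(0)+1}` (energy tightness from the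
  `χ ≡ 1` energy component at `s = 0` + conservation), `∫ b_r(y,x) dy = 1` for `r ≤ 1/2` (LANDED:
  `DensityCapNegative.coneMass_eq_one` + `integral_cone`, Theorems/DensityCap/Negative/KernelMass.lean), uniform
  continuity of `ρ` on `[0,t] × 𝕋³`, union bound over the measurable grid superset of the outer-measured event.
  [M/L, provable now]
* `stub_band`    — THE DOCK: the packing-guarded hydrodynamic limit BY NAME, the shared item stmt-9133
  (`StrongClosureWeakBV.HydroLimitInBand`; = the consequent of this route's glue `ParityInBand` verbatim).
  [open-problem; staffed once for all routes wanting 9133 — not to be attacked inside this lineage]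
* `stub_dsc`     — GUARD REMOVAL BY NAME, this route's own support item stmt-3091
  (`JParityClosure.DiluteSelfConsistency`). [open-problem, suspect-false ×6 (implosion); needed only because
  the crux is filed UNGUARDED — reshape recorded in the line card if it dies]

`DensityCap_of : stub_clock → stub_upgrade → stub_band → stub_dsc → DensityCap` (hypotheses keyed by the
registered stub names through the `Registered.*` aliases, conclusion the route decl BY NAME) is PROVED below,
no `sorry`: `σ₀ := min σ₁ σ₃` (`σ₁` band threshold, `σ₃` the guard threshold of `stub_dsc` at `η := η₀`);
for `σ < σ₀` the guard `ρσ³ < η₀` holds on `[0,T)`, `stub_band` gives `TendstoHydroFieldsAt … s` at every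
`s ≤ t < T`, and `stub_upgrade` fed with `stub_clock` returns the cap (the crux's `let`-spelled tail and the
stubs' inlined spelling agree definitionally — the kernel checks it in `DensityCap_of`).

DISPROOF USED (`Cruxes/DensityCap/Disproof.lean`, cdisprove cycle 1 — verdict RESISTS):
`densityCap_false_untied` (the `t = 0` tie is load-bearing) — honoured: the tie is a hypothesis of
`stub_band`/`stub_dsc` and is consumed a second time by `stub_upgrade` (energy tightness at `s = 0`);
`densityCap_false_noPDE` (balance laws load-bearing) — consumed inside `stub_band` (the limit IS the Euler
solution) and `stub_dsc`; `not_densityCapSwapped` / `not_densityCapAllN` (order of limits essential) —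
respected: every stub keeps `∃ r₀ ∀ r ∃ N₀ ∀ N`, and the clock bounds INCREMENTS of `ρ̄ʳ`, never its values
(no pathwise cap beyond `3/(π r³)` is claimed, cf. `atom_le_mollDensity`); §5 equilibrium instance — not used
as evidence; §6 near-miss `densityCap_of_hydrodynamicLimit` = `stub_upgrade ∘ stub_clock` applied to the
summit, here applied to the filed pair 9133 ∧ 3091 instead (non-circular at item level; circular inside
`ParityInBand`, which consumes `DensityCap` as h₅ — planner note in the line card). LANDED NEGATIVE LEMMAS
(`Theorems/DensityCap/Negative/{MollifiedDensity,KernelMass,Untied,LimitOrder,Equilibrium}.lean`, namespace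
`Theorems.DensityCapNegative`): `Untied`, `LimitOrder` (hence `MollifiedDensity`) are IMPORTED here and the stubs are
checked against them in §Checks below — no stub is an instance of `DensityCapUntied` / `DensityCapNoPDE` /
`DensityCapSwapped` / `DensityCapAllN`; the kernel-mass input of `stub_upgrade` is the landed `coneMass_eq_one`
(`KernelMass`, to be imported by the stub prover); the inline kernel of the stubs IS `DensityCapNegative.cone` /
`mollDensity` (`rfl`). `ledger negatives --problem AtomisticToContinuum` (12, read 2026-08-16T01:47Z): none
restated — the tie is kept (≠ 9168), nothing is cell-wise at finite `N` (≠ 9236/9238), no exponential velocity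
moment (≠ 14607).
-/

noncomputable section

namespace Summit.AtomisticToContinuum.HydrodynamicLimit.Cruxes.DensityCap.WeakLlnUpgrade

open scoped BigOperators Topology Classical MeasureTheory ENNReal
open Filter Set MeasureTheory
open Literature.MathematicalPhysics.KineticTheory
open Literature.Analysis.FluidPDE
open Summit.AtomisticToContinuum.HydrodynamicLimit.Theses

/-! ## The two kinematic statements of the line, as named `Prop`s (readability; the registered stubs below
spell them out verbatim over existing declarations, and `*_holds` checks the two spellings agree) -/

/-- TRANSPORT-LIPSCHITZ CLOCK. For every hard-sphere flow `Φ` of `N` spheres of diameter `ε` on `𝕋³`, every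
good datum `z`, every `L`-Lipschitz (for the minimal-image distance) position test `χ`, all real `s, s'`:
`|⟨μ_(Φ_s' z), χ⟩ − ⟨μ_(Φ_s z), χ⟩| ≤ L · |s' − s| · √(2K(z)/N)`, `K = configEnergy` (`½ ∑ᵢ ‖vᵢ‖²`, conserved
along the orbit), `√(2K/N)` = the quadratic-mean speed. -/
def TransportClock : Prop :=
  ∀ (ε : ℝ) (N : ℕ) (Φ : HardSphereFlow (Torus.geometry (Fin 3)) ε N), ∀ z ∈ Φ.good,
      ∀ (χ : T3 → ℝ) (L : ℝ), 0 ≤ L → (∀ x y : T3, |χ x - χ y| ≤ L * Torus.euclidDist x y) →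
      ∀ s s' : ℝ,
        |(∫ q, χ q.1 ∂(empiricalMeasure (Φ.flow s' z))) - ∫ q, χ q.1 ∂(empiricalMeasure (Φ.flow s z))|
          ≤ L * |s' - s| * Real.sqrt (2 * configEnergy z / N)

/-- GRID UPGRADE. Given the clock: for `σ > 0`, a classical hard-sphere-Euler solution on `[0,T)`, flows `Φ`,
`t ∈ [0,T)`, convergence in probability of the empirical hydrodynamic fields under the local Gibbs laws at
EVERY `s ∈ [0,t]` implies: `∀ η δ > 0 ∃ r₀ > 0 ∀ r ∈ (0,r₀) ∃ N₀ ∀ N ≥ N₀`, the overshoot event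
`{∃ s ∈ [0,t], ∃ x, ρ(s,x) + η < ρ̄ʳ(Φ_N(s) z)(x)}`, `ρ̄ʳ(w)(x) = ∫ 3/(π r³)(1 − d(q.1,x)/r)₊ dμ_w(q)`, has law
`≤ δ` — the crux's conclusion block with its `let`s inlined. -/
def GridUpgrade : Prop :=
  (∀ (ε : ℝ) (N : ℕ) (Φ : HardSphereFlow (Torus.geometry (Fin 3)) ε N), ∀ z ∈ Φ.good,
      ∀ (χ : T3 → ℝ) (L : ℝ), 0 ≤ L → (∀ x y : T3, |χ x - χ y| ≤ L * Torus.euclidDist x y) →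
      ∀ s s' : ℝ,
        |(∫ q, χ q.1 ∂(empiricalMeasure (Φ.flow s' z))) - ∫ q, χ q.1 ∂(empiricalMeasure (Φ.flow s z))|
          ≤ L * |s' - s| * Real.sqrt (2 * configEnergy z / N)) →
    ∀ (σ : ℝ) (a₀ θ₀ : T3 → ℝ) (u₀ : T3 → V3) (T : ℝ) (ρ θ : ℝ → T3 → ℝ) (u : ℝ → T3 → V3),
      0 < σ → IsHardSphereEulerSolution σ T ρ u θ →
      ∀ Φ : (N : ℕ) → HardSphereFlow (Torus.geometry (Fin 3)) (hsDiameter σ N) (N + 1),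
      ∀ t ∈ Set.Ico 0 T,
      (∀ s ∈ Set.Icc 0 t, TendstoHydroFieldsAt (fun N => localGibbsLaw σ a₀ u₀ θ₀ N (Φ N)) Φ ρ u θ s) →
      ∀ η δ : ℝ, 0 < η → 0 < δ → ∃ r₀ : ℝ, 0 < r₀ ∧ ∀ r : ℝ, 0 < r → r < r₀ →
        ∃ N₀ : ℕ, ∀ N : ℕ, N₀ ≤ N →
          localGibbsLaw σ a₀ u₀ θ₀ N (Φ N)
              {z | ∃ s ∈ Set.Icc 0 t, ∃ x : T3,
                ρ s x + η < ∫ q, 3 / (Real.pi * r ^ 3) * max (1 - Torus.euclidDist q.1 x / r) 0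
                  ∂(empiricalMeasure ((Φ N).flow s z))}
            ≤ ENNReal.ofReal δ

/-! ## Registered stubs (the only `sorry`s of this file) -/

/-- `stub_clock` — TRANSPORT-LIPSCHITZ CLOCK (= `TransportClock`; pathwise; size M; provable now).
Proof route: the orbit `τ ↦ Φ.flow τ z` of a good `z` is an `IsHardSphereTrajectory` (`Φ.isTrajectory`);
partition `[s, s']` by its finitely many collision times (`.locFinite`); on each stretch free flight
(`.free`, `freeFlight_apply`, `Torus.geometry_translate`) moves `xᵢ` by `proj (Δτ • vᵢ)`, so
`d(xᵢ(τ'), xᵢ(τ)) ≤ |Δτ| ‖vᵢ‖` (`Torus.euclidDist_translate_le x x a 0`, HardSphereTorusMeasure; or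
`Torus.euclidDist_proj_le_norm_sub_holds`); positions are continuous across
collisions (`.pos_continuous`), so the triangle inequality (`Torus.euclidDist_triangle`) chains the stretches;
per stretch `N⁻¹ ∑ᵢ ‖vᵢ‖ ≤ √(N⁻¹ ∑ᵢ ‖vᵢ‖²) = √(2K/N)` (Cauchy–Schwarz; `configEnergy`,
`IsHardSphereTrajectory.configEnergy_eq_holds`, `Φ.flow_zero` on `Φ.good`); `integral_empiricalMeasure`
passes between `∫ dμ_w` and `N⁻¹ ∑ᵢ`. `N = 0`: both sides are `0`. Holds for all real `s, s'` (two-sided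
orbits) and any `ε`. Used by `stub_upgrade` with `χ = b_r(·, x)`, `L = 3/(π r⁴)`. -/
theorem stub_clock :
    ∀ (ε : ℝ) (N : ℕ) (Φ : HardSphereFlow (Torus.geometry (Fin 3)) ε N), ∀ z ∈ Φ.good,
      ∀ (χ : T3 → ℝ) (L : ℝ), 0 ≤ L → (∀ x y : T3, |χ x - χ y| ≤ L * Torus.euclidDist x y) →
      ∀ s s' : ℝ,
        |(∫ q, χ q.1 ∂(empiricalMeasure (Φ.flow s' z))) - ∫ q, χ q.1 ∂(empiricalMeasure (Φ.flow s z))|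
          ≤ L * |s' - s| * Real.sqrt (2 * configEnergy z / N) := by
  sorry

/-- `stub_upgrade` — GRID UPGRADE (= `GridUpgrade`; size M/L; provable now; paper proof Disproof §6).
GIVEN the clock (first hypothesis = `stub_clock`'s statement verbatim): fix `η, δ`. (1) `ρ` is uniformly
continuous on the compact `[0,t] × 𝕋³` (`IsHardSphereEulerSolution.smooth_density`, `t < T`); take
`r₀ ≤ 1/2` with `osc_(B_r(x)) ρ(s,·) < η/4` for `r < r₀`, all `s ≤ t`; with `b_r ≥ 0`, `b_r(y,x) = 0` for
`d(y,x) ≥ r` and `∫ b_r(y, x) dy = 1` (`r ≤ 1/2`: LANDED `DensityCapNegative.coneMass_eq_one` + `integral_cone` +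
`euclidDist_comm`, import `…Theorems.DensityCap.Negative.KernelMass`) get `∫ b_r(y,x) ρ(s,y) dy ≤ ρ(s,x) + η/4`;
`DensityCapNegative.cone_le` / `cone_nonneg` / `mollDensity_eq` are the landed kernel facts. (2) Fix `r < r₀`; `b_r(·, x)` is
`3/(π r⁴)`-Lipschitz (`t ↦ (1 − t/r)₊` is `1/r`-Lipschitz, `euclidDist_triangle`, `euclidDist_comm`);
`K̄ := ∫ E(0) + 1`; the energy component of the `s = 0` convergence with `χ ≡ 1` gives
`P_N {1 < |K(Φ_N(0) z)/(N+1) − ∫E(0)|} → 0`, and `Φ_N(0) z = z` on the good set (`flow_zero`), whose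
complement is law-null (`localGibbsLaw` = `particleLaw` = `liouville.withDensity _`, `measure_compl_good`).
(3) On `good ∩ {K/(N+1) ≤ K̄}` the map `(s, x) ↦ ρ̄ʳ(Φ_N(s) z)(x)` is `3√(2K̄)/(π r⁴)`-Lipschitz in `s` (the
clock) and `3/(π r⁴)`-Lipschitz in `x`, uniformly in `N`; choose a finite grid `(s_k, x_l)` of `[0,t] × 𝕋³`
(compact; `continuous_euclidDist`) of mesh making both increments and `osc ρ` `< η/4`. (4) The overshoot
event is contained in `goodᶜ ∪ {K̄ < K/(N+1)} ∪ ⋃_(k,l) {η/4 < |empiricalDensityField (Φ_N(s_k) z) (b_r(·,x_l))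
− ∫ b_r(y,x_l) ρ(s_k,y) dy|}` (`empiricalDensityField` with the continuous test `b_r(·, x_l)` IS
`ρ̄ʳ(·)(x_l)`); each of the finitely many grid events tends to `0` by the density component at `s_k ∈ [0,t]`;
union bound (outer measure: `measure_mono`, `measure_union_le`, `measure_biUnion_finset_le`), finitely many
`ℝ≥0∞` null sequences ⇒ `∃ N₀`. Neither probability-ness nor continuity of the profiles is needed (the laws may
be junk measures `≪` Liouville: the bound is a finite sum of hypothesis-given null sequences). -/
theorem stub_upgrade :
    (∀ (ε : ℝ) (N : ℕ) (Φ : HardSphereFlow (Torus.geometry (Fin 3)) ε N), ∀ z ∈ Φ.good,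
      ∀ (χ : T3 → ℝ) (L : ℝ), 0 ≤ L → (∀ x y : T3, |χ x - χ y| ≤ L * Torus.euclidDist x y) →
      ∀ s s' : ℝ,
        |(∫ q, χ q.1 ∂(empiricalMeasure (Φ.flow s' z))) - ∫ q, χ q.1 ∂(empiricalMeasure (Φ.flow s z))|
          ≤ L * |s' - s| * Real.sqrt (2 * configEnergy z / N)) →
    ∀ (σ : ℝ) (a₀ θ₀ : T3 → ℝ) (u₀ : T3 → V3) (T : ℝ) (ρ θ : ℝ → T3 → ℝ) (u : ℝ → T3 → V3),
      0 < σ → IsHardSphereEulerSolution σ T ρ u θ →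
      ∀ Φ : (N : ℕ) → HardSphereFlow (Torus.geometry (Fin 3)) (hsDiameter σ N) (N + 1),
      ∀ t ∈ Set.Ico 0 T,
      (∀ s ∈ Set.Icc 0 t, TendstoHydroFieldsAt (fun N => localGibbsLaw σ a₀ u₀ θ₀ N (Φ N)) Φ ρ u θ s) →
      ∀ η δ : ℝ, 0 < η → 0 < δ → ∃ r₀ : ℝ, 0 < r₀ ∧ ∀ r : ℝ, 0 < r → r < r₀ →
        ∃ N₀ : ℕ, ∀ N : ℕ, N₀ ≤ N →
          localGibbsLaw σ a₀ u₀ θ₀ N (Φ N)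
              {z | ∃ s ∈ Set.Icc 0 t, ∃ x : T3,
                ρ s x + η < ∫ q, 3 / (Real.pi * r ^ 3) * max (1 - Torus.euclidDist q.1 x / r) 0
                  ∂(empiricalMeasure ((Φ N).flow s z))}
            ≤ ENNReal.ofReal δ := by
  sorry

/-- `stub_band` — THE DOCK: the packing-guarded hydrodynamic limit, BY NAME the shared statement item
stmt-AtomisticToContinuum-9133 (`StrongClosureWeakBV.HydroLimitInBand`, wanted by LaxScheme, GermanoSplitLES,
StrongClosureWeakBV, ImplosionDichotomy, LoschmidtIsentropicSelection, SuperextensiveClosureCost,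
EulerCharacteristics; verbatim the consequent of `JParityClosure.ParityInBand`). Open problem; carries the
whole dynamical content of the crux (the crux is EQUIVALENT to the density third of its conclusion, uniformly
in time — triage common finding); closes when 9133 closes anywhere (`exact StrongClosureWeakBV.…_holds`). -/
theorem stub_band : StrongClosureWeakBV.HydroLimitInBand := by
  sorry

/-- `stub_dsc` — GUARD REMOVAL, BY NAME this route's own support item stmt-AtomisticToContinuum-3091
(`JParityClosure.DiluteSelfConsistency`, shared by 30+ routes): tied classical solutions stay below any
reduced density `η` on `[0,T)` once `σ < σ₀(η, profiles)`. Open; flagged suspect-false (implosion: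
`DenseExcursion → ¬ DiluteSelfConsistency` is a checked negative glue on 3091, `DenseExcursion` unproved).
Needed ONLY because the crux is filed unguarded (`∀` classical solutions up to `T`); if it is refuted the
route's `closes` breaks at the same item and the line is reshaped as recorded in the line card
(`densityCapGuarded_of` below is the 3091-free content). -/
theorem stub_dsc : JParityClosure.DiluteSelfConsistency := by
  sorry

/-! ## Consistency: the named statements ARE the registered stubs (syntactically) -/

theorem transportClock_holds : TransportClock := stub_clock
theorem gridUpgrade_holds : GridUpgrade := stub_upgrade

/-! ## Name-keyed aliases (the skeleton audit admits a hypothesis of the composition only if its head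
constant is a registered obligation — `stub_band`, `stub_dsc` are route items by name — or is named like a
declared stub) -/
namespace Registered

/-- Alias of `TransportClock` keyed by the registered stub name `stub_clock`. -/
abbrev stub_clock : Prop := TransportClock
/-- Alias of `GridUpgrade` keyed by the registered stub name `stub_upgrade`. -/
abbrev stub_upgrade : Prop := GridUpgrade

end Registered

/-! ## Composition (sorry-free): the four stubs imply the crux BY NAME -/

/-- `DensityCap` from the four stubs (pure quantifier bookkeeping, no `sorry`): `σ₀ := min σ₁ σ₃` with `σ₁`
from `stub_band` (band `η₀`) and `σ₃` from `stub_dsc` at `η := η₀`; for `σ < σ₀` the guard `ρσ³ < η₀`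
holds on `[0,T)`, so `stub_band` yields `TendstoHydroFieldsAt … s` at every `s ∈ [0,t]` (`t < T`), and
`stub_upgrade` fed with `stub_clock` turns that into the cap (the crux's `let`-tail, definitionally). -/
theorem DensityCap_of (hClock : Registered.stub_clock) (hUp : Registered.stub_upgrade)
    (hBand : StrongClosureWeakBV.HydroLimitInBand) (hDsc : JParityClosure.DiluteSelfConsistency) :
    JParityClosure.DensityCap := by
  obtain ⟨η₀, hη₀, hIB⟩ := hBand
  intro a₀ θ₀ u₀ ha hθ hu ha0 hθ0
  obtain ⟨σ₁, hσ₁, h1⟩ := hIB a₀ θ₀ u₀ ha hθ hu ha0 hθ0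
  obtain ⟨σ₃, hσ₃, h3⟩ := hDsc η₀ hη₀ a₀ θ₀ u₀ ha hθ hu ha0 hθ0
  refine ⟨min σ₁ σ₃, lt_min hσ₁ hσ₃, ?_⟩
  intro σ hσ hσlt T ρ θ u hE Φ h0 t ht η δ hη hδ
  have hσ1 : σ < σ₁ := lt_of_lt_of_le hσlt (min_le_left _ _)
  have hσ3 : σ < σ₃ := lt_of_lt_of_le hσlt (min_le_right _ _)
  have hguard : ∀ t ∈ Set.Ico 0 T, ∀ x, ρ t x * σ ^ 3 < η₀ := h3 σ hσ hσ3 T ρ θ u hE Φ h0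
  have hall : ∀ s ∈ Set.Icc 0 t,
      TendstoHydroFieldsAt (fun N => localGibbsLaw σ a₀ u₀ θ₀ N (Φ N)) Φ ρ u θ s := by
    intro s hs
    exact h1 σ hσ hσ1 T ρ θ u hE hguard Φ h0 s ⟨hs.1, lt_of_le_of_lt hs.2 ht.2⟩
  exact hUp hClock σ a₀ θ₀ u₀ T ρ θ u hσ hE Φ t ht hall η δ hη hδ

/-- Wiring check: the registered stubs feed `DensityCap_of` exactly as stated (an `example`, so that
`DensityCap_of` stays the file's only theorem concluding the crux). -/
example : JParityClosure.DensityCap := DensityCap_of stub_clock stub_upgrade stub_band stub_dsc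

/-- GUARDED COROLLARY (triage r1-2 sharpening, recorded for the tenure planner; sorry-free given the stubs it
names): WITHOUT `stub_dsc`, the clock + the grid upgrade + the band statement already give the cap for every
classical solution that stays in the band `ρσ³ < η₀` — the form in which `ParityInBand` actually consumes h₅
(= IdeatorOne's `DensityCapGuarded`). If stmt-3091 dies, THIS is the statement the crux should be re-cut to
(planner action, not this line's). -/
theorem densityCapGuarded_of (hClock : Registered.stub_clock) (hUp : Registered.stub_upgrade)
    (hBand : StrongClosureWeakBV.HydroLimitInBand) :
    ∃ η₀ : ℝ, 0 < η₀ ∧ ∀ (a₀ θ₀ : T3 → ℝ) (u₀ : T3 → V3), Continuous a₀ → Continuous θ₀ → Continuous u₀ →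
      (∀ x, 0 < a₀ x) → (∀ x, 0 < θ₀ x) → ∃ σ₀ : ℝ, 0 < σ₀ ∧ ∀ σ : ℝ, 0 < σ → σ < σ₀ →
      ∀ (T : ℝ) (ρ θ : ℝ → T3 → ℝ) (u : ℝ → T3 → V3), IsHardSphereEulerSolution σ T ρ u θ →
      (∀ t ∈ Set.Ico 0 T, ∀ x, ρ t x * σ ^ 3 < η₀) →
      ∀ Φ : (N : ℕ) → HardSphereFlow (Torus.geometry (Fin 3)) (hsDiameter σ N) (N + 1),
      TendstoHydroFieldsAt (fun N => localGibbsLaw σ a₀ u₀ θ₀ N (Φ N)) Φ ρ u θ 0 →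
      ∀ t ∈ Set.Ico 0 T, ∀ η δ : ℝ, 0 < η → 0 < δ → ∃ r₀ : ℝ, 0 < r₀ ∧ ∀ r : ℝ, 0 < r → r < r₀ →
        ∃ N₀ : ℕ, ∀ N : ℕ, N₀ ≤ N →
          localGibbsLaw σ a₀ u₀ θ₀ N (Φ N)
              {z | ∃ s ∈ Set.Icc 0 t, ∃ x : T3,
                ρ s x + η < ∫ q, 3 / (Real.pi * r ^ 3) * max (1 - Torus.euclidDist q.1 x / r) 0
                  ∂(empiricalMeasure ((Φ N).flow s z))}
            ≤ ENNReal.ofReal δ := by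
  obtain ⟨η₀, hη₀, hIB⟩ := hBand
  refine ⟨η₀, hη₀, ?_⟩
  intro a₀ θ₀ u₀ ha hθ hu ha0 hθ0
  obtain ⟨σ₁, hσ₁, h1⟩ := hIB a₀ θ₀ u₀ ha hθ hu ha0 hθ0
  refine ⟨σ₁, hσ₁, ?_⟩
  intro σ hσ hσlt T ρ θ u hE hguard Φ h0 t ht η δ hη hδ
  have hall : ∀ s ∈ Set.Icc 0 t,
      TendstoHydroFieldsAt (fun N => localGibbsLaw σ a₀ u₀ θ₀ N (Φ N)) Φ ρ u θ s := by
    intro s hs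
    exact h1 σ hσ hσlt T ρ θ u hE hguard Φ h0 s ⟨hs.1, lt_of_le_of_lt hs.2 ht.2⟩
  exact hUp hClock σ a₀ θ₀ u₀ T ρ θ u hσ hE Φ t ht hall η δ hη hδ

/-! ## Checks against the landed `Negative/*` lemmas and the vocabulary bridge (imported above; all `example`s) -/

/-- VOCABULARY BRIDGE (`rfl`): the inline kernel/mollifier of the stubs IS the landed `DensityCapNegative.cone` /
`mollDensity` of `Theorems/DensityCap/Negative/MollifiedDensity.lean`, so stub provers may `show`/`change` to it and
use `mollDensity_eq`, `cone_le`, `cone_nonneg`, `atom_le_mollDensity`, `integral_cone`, `coneMass_eq_one` directly. -/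
example (r : ℝ) {n : ℕ} (w : Config n (Fin 3) T3) (x₀ : T3) :
    Theorems.DensityCapNegative.mollDensity r w x₀ =
      ∫ q, 3 / (Real.pi * r ^ 3) * max (1 - Torus.euclidDist q.1 x₀ / r) 0 ∂(empiricalMeasure w) := rfl

/-- KERNEL MASS (input (1) of `stub_upgrade`): `∫ x₀, b_r(y, x₀) = coneMass r` for every `y` is LANDED
(`integral_cone`, MollifiedDensity.lean; swap the arguments with `Torus.euclidDist_comm`), and `coneMass r = 1` for
`0 < r ≤ 1/2` is LANDED as `DensityCapNegative.coneMass_eq_one` in `Theorems/DensityCap/Negative/KernelMass.lean`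
(not imported here only because that module was not yet built on the farm when this skeleton was checked; the stub
prover imports it). -/
example (r : ℝ) (y : T3) :
    ∫ x₀, Theorems.DensityCapNegative.cone r y x₀ = Theorems.DensityCapNegative.coneMass r :=
  Theorems.DensityCapNegative.integral_cone r y

/-- LOAD-BEARING MAP honoured (`Negative/Untied.lean`): the untied and the PDE-free variants are FALSE. In this line
the tie `TendstoHydroFieldsAt … 0` and `IsHardSphereEulerSolution` are hypotheses of `stub_band` / `stub_dsc` (by
name, inside 9133 / 3091) and are threaded to them by `DensityCap_of` (`h0`, `hE`); `stub_upgrade` consumes the tie a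
second time through `∀ s ∈ [0,t]` at `s = 0` (energy tightness). -/
example : ¬ Theorems.DensityCapNegative.DensityCapUntied := Theorems.DensityCapNegative.densityCap_false_untied
example : ¬ Theorems.DensityCapNegative.DensityCapNoPDE := Theorems.DensityCapNegative.densityCap_false_noPDE

/-- LIMIT ORDER honoured (`Negative/LimitOrder.lean`): `∃ N₀` before `∀ r` and `∀ N` are FALSE. `stub_upgrade` (and
`densityCapGuarded_of`) keep the crux's order `∃ r₀ ∀ r ∃ N₀ ∀ N` verbatim; `stub_clock` is a pathwise bound on
INCREMENTS whose constant `3√(2K/N)/(π r⁴)` (with `L = 3/(π r⁴)`) blows up as `r → 0`, consistent with the atom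
`atom_le_mollDensity` — no sure cap on values is claimed anywhere. -/
example : ¬ Theorems.DensityCapNegative.DensityCapSwapped := Theorems.DensityCapNegative.not_densityCapSwapped
example : ¬ Theorems.DensityCapNegative.DensityCapAllN := Theorems.DensityCapNegative.not_densityCapAllN

end Summit.AtomisticToContinuum.HydrodynamicLimit.Cruxes.DensityCap.WeakLlnUpgrade

end
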